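import Mathlib
import Summits.Ventures.FusionMHD.Models.FluxSurfacePolarRayLevelForceBalance
import Literature.MathematicalPhysics.MHD.SolovevFluxSurfaceGGJResistive
import HarnessLib

/-!
# Polar-ray chart, LEVEL direction (IX): the RESISTIVE-INTERCHANGE INDEX `D_R` (Glasser–Greene–Johnson 1975; Zheng (3.42)) of an
# implicit flux surface in EIGHT θ-integral registers — the two further averages `⟨σB²⟩ = Cg`, `⟨B²⟩ = ∫bsqKernel ÷ ∫volKernel`,
# GGJ's `H` in registers, `D_R = D_I + (H − 1/2)²`, and `D_R < 0 ⇒` Mercier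

LADDER-GRIDFUSION (F3 scoping input R3 «GGJ regime»; F2 item R2), cell `gridfusion`, seat `gridfusion-model-7` (g6), 2026-08-27.
Companion of `Models/FluxSurfacePolarRayLevelForceBalance.lean` (force balance of `PolarRay.ggjData` — the hypothesis of every
relabelling lemma — and `D_I` in six registers) and of gridfusion-model-5's GENERIC §1 of
`Literature/…/SolovevFluxSurfaceGGJResistive.lean` (`ggjH/ggjF/ggjE/ggjDR_relabel_volume`, `ggjDR_relabel_volume_eq`,
`mercierCriterion_of_ggjDR_relabel_volume_neg`: the printed Hamada-label pieces of volume-relabelled data).  Conventions as in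
`…LevelGGJ.lean`.

WHAT IS PROVED ([folklore] calculus + the printed functionals):
* §1 `bsqKernel g R_c D G θ s = (g² + G)·volKernel/R²` (kernel of `V′⟨B²⟩/2π`, `B² = (g² + G)/R²`) with continuity and θ-congruence;
  `LevelLoop.surfaceAverageE_bsq_eq` (`⟨B²⟩ = ∫bsqKernel ÷ ∫volKernel`), `LevelLoop.surfaceAverageE_sigmaBsq_eq` (`⟨σB²⟩ = C·g`, a
  surface constant), `LevelLoop.ggjData_gB2_pos` (`⟨B²/|∇ψ|²⟩ > 0` — removes that hypothesis from the `D_I` register form).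
* §2 `resistiveIndexE g C ψ R_c Z_c u` := GGJ's `D_R` of the volume (Hamada) relabelling of `ggjData` with the surface's own `⟨σB²⟩`,
  `⟨B²⟩`; **`LevelLoop.ggjH_ggjData_eq`** (`H = −(C/Pd)·(Aσ − AB·W/A2)`), **`LevelLoop.resistiveIndexE_eq_registerForm`**:
  `D_R = −mercierRegisterForm/(4g²Pd²) + (−(C/Pd)(Aσ − AB·W/A2) − 1/2)²` in the EIGHT registers `Pd, Wd, Aσ, As, AB, Ai`
  (as in `mercierNumerator_ggjData`), `W = ∫volKernel`, `A2 = ∫bsqKernel`; and **`LevelLoop.mercierCriterion_of_resistiveIndexE_neg`**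
  (`D_R < 0 ⇒` Jardin's (8.134) on the surface; GGJ: the resistive-stable range implies ideal interchange stability a fortiori).
MODELLED: ideal-MHD equilibrium inputs of the GGJ resistive singular-layer index (constant resistivity, asymptotic matching;
HamEtAl2013: `D_R` «normally a small negative number» in tokamaks — a VALIDATED expectation, not asserted); Solov'ev-class profiles;
statements about MODEL surfaces — never a device, never «stable».  NOT CLAIMED: any value; the sign of `Pd` (shear) is a hypothesis.
-/

noncomputable section

open Real Set Filter Topology MeasureTheory intervalIntegral
open Literature.MathematicalPhysics.MHD Literature.MathematicalPhysics.MHD.GradShafranov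
  Literature.MathematicalPhysics.MHD.FluxGeometry Literature.MathematicalPhysics.MHD.Mercier.FluxForm

namespace Summit.Ventures.FusionMHD.Models

namespace PolarRay

/-! ## §1 `⟨B²⟩` and `⟨σB²⟩` on the glued loop -/

/-- Kernel of `V′⟨B²⟩/2π`: `(g² + G)·volKernel/R²` (`B² = (g² + G)/R²`). [cite: Zheng2015, §2.3 eq. (2.64)] -/
def bsqKernel (g Rc : ℝ) (D G : ℝ → ℝ → ℝ) (θ s : ℝ) : ℝ := (g ^ 2 + G θ s) * volKernel Rc D θ s / (Rc + s * cos θ) ^ 2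

/-- Joint continuity of `bsqKernel` (`D ≠ 0`, `R ≠ 0`). [folklore] -/
theorem continuousOn_bsqKernel {g Rc : ℝ} {D G : ℝ → ℝ → ℝ} {K : Set (ℝ × ℝ)}
    (hDc : ContinuousOn (fun p : ℝ × ℝ => D p.1 p.2) K) (hGc : ContinuousOn (fun p : ℝ × ℝ => G p.1 p.2) K)
    (hD0 : ∀ p ∈ K, D p.1 p.2 ≠ 0) (hR : ∀ p ∈ K, Rc + p.2 * cos p.1 ≠ 0) :
    ContinuousOn (fun p : ℝ × ℝ => bsqKernel g Rc D G p.1 p.2) K := by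
  unfold bsqKernel
  refine ContinuousOn.div ?_ (by fun_prop) fun p hp => pow_ne_zero 2 (hR p hp)
  exact ((by fun_prop : ContinuousOn (fun p : ℝ × ℝ => g ^ 2) K).add hGc).mul (continuousOn_volKernel hDc hD0)

/-- θ-congruence of `bsqKernel` (θ enters through `cos θ` and the fields). [folklore] -/
theorem bsqKernel_congr_theta {g Rc : ℝ} {D G : ℝ → ℝ → ℝ} {θ θ' s : ℝ} (hcos : cos θ' = cos θ) (hD : D θ' s = D θ s)
    (hG : G θ' s = G θ s) : bsqKernel g Rc D G θ' s = bsqKernel g Rc D G θ s := by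
  unfold bsqKernel volKernel; rw [hcos, hD, hG]

namespace LevelLoop

variable {ψ : ℝ → ℝ → ℝ} {Rc Zc uin uout smax C : ℝ} {D D₁ G k kθ : ℝ → ℝ → ℝ} {N : ℕ} {t σ₁ σ₂ : ℕ → ℝ}
  {L : ℝ → ℝ → (ℝ × ℝ →L[ℝ] ℝ)}

/-- **`⟨B²⟩ = ∫₀^{2π} bsqKernel ÷ ∫₀^{2π} volKernel`** on the glued loop (constant `F ≡ g`). [cite: Zheng2015, §2.3 eq. (2.64)] -/
theorem surfaceAverageE_bsq_eq (Λ : LevelLoop ψ Rc Zc uin uout D N t σ₁ σ₂) (g : ℝ)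
    (hψ : ∀ j < N, ∀ θ ∈ Icc (t j) (t (j + 1)), ∀ s ∈ Icc (σ₁ j) (σ₂ j),
      HasFDerivAt (fun p : ℝ × ℝ => ψ p.1 p.2) (L θ s) (rayPoint Rc Zc θ s))
    (hR : ∀ j < N, ∀ θ ∈ Icc (t j) (t (j + 1)), ∀ s ∈ Icc (σ₁ j) (σ₂ j), 0 < Rc + s * cos θ)
    (hG : ∀ j < N, ∀ θ ∈ Icc (t j) (t (j + 1)), ∀ s ∈ Icc (σ₁ j) (σ₂ j), (L θ s (1, 0)) ^ 2 + (L θ s (0, 1)) ^ 2 = G θ s)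
    {u : ℝ} (hu : u ∈ Ioo uin uout) :
    surfaceAverageE ψ (loop Rc Zc (rayRadius ψ Rc Zc u)) (2 * π) (fieldBsq (fun _ => g) ψ)
      = (∫ θ in (0 : ℝ)..(2 * π), bsqKernel g Rc D G θ (rayRadius ψ Rc Zc u θ))
          / ∫ θ in (0 : ℝ)..(2 * π), volKernel Rc D θ (rayRadius ψ Rc Zc u θ) := by
  have hI : uIcc 0 (2 * π) = Icc 0 (2 * π) := uIcc_of_le two_pi_pos.le
  rw [Λ.surfaceAverageE_eq hψ hR hu]
  congr 1
  apply intervalIntegral.integral_congr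
  intro θ hθ
  rw [hI] at hθ
  obtain ⟨hRpos, -, hB⟩ := Λ.point_facts g hψ hR hG hu hθ
  simp only [loop]
  rw [hB]
  unfold bsqKernel
  ring

/-- **`⟨σB²⟩ = C·g`** (`σB² = gΔ*ψ/R² ≡ Cg` is a surface — indeed global — constant). [cite: Zheng2015, §2.3 eq. (2.64)] -/
theorem surfaceAverageE_sigmaBsq_eq (Λ : LevelLoop ψ Rc Zc uin uout D N t σ₁ σ₂) (g : ℝ)
    (hψ : ∀ j < N, ∀ θ ∈ Icc (t j) (t (j + 1)), ∀ s ∈ Icc (σ₁ j) (σ₂ j),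
      HasFDerivAt (fun p : ℝ × ℝ => ψ p.1 p.2) (L θ s) (rayPoint Rc Zc θ s))
    (hR : ∀ j < N, ∀ θ ∈ Icc (t j) (t (j + 1)), ∀ s ∈ Icc (σ₁ j) (σ₂ j), 0 < Rc + s * cos θ)
    (hGS : ∀ j < N, ∀ θ ∈ Icc (t j) (t (j + 1)), ∀ s ∈ Icc (σ₁ j) (σ₂ j),
      gsOperator ψ (Rc + s * cos θ) (Zc + s * sin θ) = C * (Rc + s * cos θ) ^ 2)
    {u : ℝ} (hu : u ∈ Ioo uin uout) :
    surfaceAverageE ψ (loop Rc Zc (rayRadius ψ Rc Zc u)) (2 * π) (fun R Z => g * gsOperator ψ R Z / R ^ 2) = C * g := by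
  have hI : uIcc 0 (2 * π) = Icc 0 (2 * π) := uIcc_of_le two_pi_pos.le
  refine surfaceAverageE_of_const (Λ.volumeDerivE_pos hψ hR hu).ne' fun θ hθ => ?_
  rw [hI] at hθ
  simp only [loop]
  exact Λ.sigmaBsq_eq g hR hGS hu hθ

/-- `⟨B²/|∇ψ|²⟩ > 0` on the implicit surface (the kernel `bsqGradKernel` is positive: `R, D, G = D_r² + D_t² > 0`).
[cite: Jardin2010, §8.5.4 eq. (8.134)] -/
theorem ggjData_gB2_pos (Λ : LevelLoop ψ Rc Zc uin uout D N t σ₁ σ₂) (g C : ℝ)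
    (hψ : ∀ j < N, ∀ θ ∈ Icc (t j) (t (j + 1)), ∀ s ∈ Icc (σ₁ j) (σ₂ j),
      HasFDerivAt (fun p : ℝ × ℝ => ψ p.1 p.2) (L θ s) (rayPoint Rc Zc θ s))
    (hR : ∀ j < N, ∀ θ ∈ Icc (t j) (t (j + 1)), ∀ s ∈ Icc (σ₁ j) (σ₂ j), 0 < Rc + s * cos θ)
    (hG : ∀ j < N, ∀ θ ∈ Icc (t j) (t (j + 1)), ∀ s ∈ Icc (σ₁ j) (σ₂ j), (L θ s (1, 0)) ^ 2 + (L θ s (0, 1)) ^ 2 = G θ s)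
    (hGc : ∀ j < N, ContinuousOn (fun p : ℝ × ℝ => G p.1 p.2) (Icc (t j) (t (j + 1)) ×ˢ Icc (σ₁ j) (σ₂ j)))
    {u : ℝ} (hu : u ∈ Ioo uin uout) :
    0 < (ggjData g C ψ Rc Zc u).gB2 := by
  obtain ⟨hρ0, -, hDeq, -, hR'⟩ := Λ.loop_hyps hψ hR hu
  have hI : uIcc 0 (2 * π) = Icc 0 (2 * π) := uIcc_of_le two_pi_pos.le
  rw [Λ.ggjData_gB2 g C hψ hR hG hu]
  refine div_pos ?_ (Λ.integral_volKernel_pos hψ hR hu)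
  -- G > 0 and continuity on boxes
  have hGpos : ∀ j < N, ∀ θ ∈ Icc (t j) (t (j + 1)), ∀ s ∈ Icc (σ₁ j) (σ₂ j), 0 < G θ s := by
    intro j hj θ hθ s hs
    rw [← hG j hj θ hθ s hs, gradSq_eq _ _ θ]
    have hslope := radialDeriv_eq_of_hasDerivAt (hψ j hj θ hθ s hs) ((Λ.panel j hj).slope θ hθ s hs)
    have hDpos := (Λ.panel j hj).slopePos θ hθ s hs
    rw [hslope]
    nlinarith [sq_nonneg (tangentialDeriv (L θ s (1, 0)) (L θ s (0, 1)) θ)]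
  have hcont : ContinuousOn (fun θ => bsqGradKernel g Rc D G θ (rayRadius ψ Rc Zc u θ)) (Icc 0 (2 * π)) := by
    have h := (continuousOn_Icc_of_chain (f := fun θ => bsqGradKernel g Rc D G θ (rayRadius ψ Rc Zc u θ)) N Λ.mono
      fun j hj => (Λ.panel j hj).continuousOn_kernel
        (continuousOn_bsqGradKernel (Λ.panel j hj).slopeCont (hGc j hj)
          (fun p hp => ((Λ.panel j hj).slopePos p.1 hp.1 p.2 hp.2).ne') (fun p hp => (hGpos j hj p.1 hp.1 p.2 hp.2).ne')
          (fun p hp => (hR j hj p.1 hp.1 p.2 hp.2).ne')) hu).2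
    rwa [Λ.t_zero, Λ.t_last] at h
  refine intervalIntegral.intervalIntegral_pos_of_pos_on (hcont.intervalIntegrable_of_Icc two_pi_pos.le) (fun θ hθ => ?_) two_pi_pos
  have hθI : θ ∈ Icc 0 (2 * π) := Ioo_subset_Icc_self hθ
  have hθ' : θ ∈ uIcc 0 (2 * π) := by rw [hI]; exact hθI
  obtain ⟨j, hj, hθj⟩ := Λ.exists_panel hθI
  have hmem : rayRadius ψ Rc Zc u θ ∈ Icc (σ₁ j) (σ₂ j) := Ioo_subset_Icc_self ((Λ.panel j hj).spec hu hθj).1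
  have hGp := hGpos j hj θ hθj _ hmem
  have hRp := hR' θ hθ'
  have hDp := (hDeq θ hθ').2
  have hρp := hρ0 θ hθ'
  unfold bsqGradKernel volKernel
  simp only [loop] at hRp
  positivity

end LevelLoop

/-! ## §2 The resistive-interchange index of the surface in eight registers -/

/-- THE RESISTIVE-INTERCHANGE INDEX `D_R` OF THE IMPLICIT SURFACE `ψ = u`: GGJ's `D_R = F + E + H²` (Zheng (3.42)) of the VOLUME
(Hamada) relabelling of the (8.134) record `ggjData g C ψ R_c Z_c u`, with the surface's own `⟨σB²⟩` and `⟨B²⟩` (Jardin (5.30) on the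
glued loop).  MODELLED: ideal-MHD equilibrium inputs of the GGJ resistive layer; Solov'ev-class profiles.
[cite: Zheng2015, §3.2 eq. (3.42)] -/
def resistiveIndexE (g C : ℝ) (ψ : ℝ → ℝ → ℝ) (Rc Zc u : ℝ) : ℝ :=
  ((ggjData g C ψ Rc Zc u).relabel (ggjData g C ψ Rc Zc u).V' (ggjData g C ψ Rc Zc u).V'').ggjDR
    (surfaceAverageE ψ (loop Rc Zc (rayRadius ψ Rc Zc u)) (2 * π) (fun R Z => g * gsOperator ψ R Z / R ^ 2))
    (surfaceAverageE ψ (loop Rc Zc (rayRadius ψ Rc Zc u)) (2 * π) (fieldBsq (fun _ => g) ψ))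

namespace LevelLoop

variable {ψ : ℝ → ℝ → ℝ} {Rc Zc uin uout smax C : ℝ} {D D₁ G k kθ : ℝ → ℝ → ℝ} {N : ℕ} {t σ₁ σ₂ : ℕ → ℝ}
  {L : ℝ → ℝ → (ℝ × ℝ →L[ℝ] ℝ)}

/-- **GGJ's `H` OF THE SURFACE IN REGISTERS**: for the Hamada relabelling, with `⟨σB²⟩ = Cg` and `⟨B²⟩ = A2/W`,
`H = −(C/Pd)·(Aσ − AB·W/A2)` (`W = ∫volKernel`, `A2 = ∫bsqKernel`, `Pd`, `Aσ`, `AB` as in `mercierNumerator_ggjData`; `g, Pd, A2 ≠ 0`).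
[cite: Zheng2015, §2.3 eq. (2.64)] -/
theorem ggjH_ggjData_eq (Λ : LevelLoop ψ Rc Zc uin uout D N t σ₁ σ₂) (g : ℝ)
    (hψ : ∀ j < N, ∀ θ ∈ Icc (t j) (t (j + 1)), ∀ s ∈ Icc (σ₁ j) (σ₂ j),
      HasFDerivAt (fun p : ℝ × ℝ => ψ p.1 p.2) (L θ s) (rayPoint Rc Zc θ s))
    (hR : ∀ j < N, ∀ θ ∈ Icc (t j) (t (j + 1)), ∀ s ∈ Icc (σ₁ j) (σ₂ j), 0 < Rc + s * cos θ)
    (hD₁ : ∀ j < N, ∀ θ ∈ Icc (t j) (t (j + 1)), ∀ s ∈ Icc (σ₁ j) (σ₂ j), HasDerivAt (D θ) (D₁ θ s) s)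
    (hD₁c : ∀ j < N, ContinuousOn (fun p : ℝ × ℝ => D₁ p.1 p.2) (Icc (t j) (t (j + 1)) ×ˢ Icc (σ₁ j) (σ₂ j)))
    (hG : ∀ j < N, ∀ θ ∈ Icc (t j) (t (j + 1)), ∀ s ∈ Icc (σ₁ j) (σ₂ j), (L θ s (1, 0)) ^ 2 + (L θ s (0, 1)) ^ 2 = G θ s)
    (hGc : ∀ j < N, ContinuousOn (fun p : ℝ × ℝ => G p.1 p.2) (Icc (t j) (t (j + 1)) ×ˢ Icc (σ₁ j) (σ₂ j)))
    (hGS : ∀ j < N, ∀ θ ∈ Icc (t j) (t (j + 1)), ∀ s ∈ Icc (σ₁ j) (σ₂ j),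
      gsOperator ψ (Rc + s * cos θ) (Zc + s * sin θ) = C * (Rc + s * cos θ) ^ 2)
    {u : ℝ} (hu : u ∈ Ioo uin uout) (hg : g ≠ 0)
    (hPd : (∫ θ in (0 : ℝ)..(2 * π), polarKernelDs Rc D D₁ θ (rayRadius ψ Rc Zc u θ) / D θ (rayRadius ψ Rc Zc u θ)) ≠ 0)
    (hA2 : (∫ θ in (0 : ℝ)..(2 * π), bsqKernel g Rc D G θ (rayRadius ψ Rc Zc u θ)) ≠ 0) :
    ((ggjData g C ψ Rc Zc u).relabel (ggjData g C ψ Rc Zc u).V' (ggjData g C ψ Rc Zc u).V'').ggjH (C * g)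
        ((∫ θ in (0 : ℝ)..(2 * π), bsqKernel g Rc D G θ (rayRadius ψ Rc Zc u θ))
          / ∫ θ in (0 : ℝ)..(2 * π), volKernel Rc D θ (rayRadius ψ Rc Zc u θ))
      = -(C / (∫ θ in (0 : ℝ)..(2 * π), polarKernelDs Rc D D₁ θ (rayRadius ψ Rc Zc u θ) / D θ (rayRadius ψ Rc Zc u θ)))
        * ((∫ θ in (0 : ℝ)..(2 * π), invGradKernel Rc D G θ (rayRadius ψ Rc Zc u θ))
          - (∫ θ in (0 : ℝ)..(2 * π), bsqGradKernel g Rc D G θ (rayRadius ψ Rc Zc u θ))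
            * (∫ θ in (0 : ℝ)..(2 * π), volKernel Rc D θ (rayRadius ψ Rc Zc u θ))
            / ∫ θ in (0 : ℝ)..(2 * π), bsqKernel g Rc D G θ (rayRadius ψ Rc Zc u θ)) := by
  have hV' := Λ.ggjData_V' g C hψ hR hu
  have hW := (Λ.integral_volKernel_pos hψ hR hu).ne'
  have hΦ2 := Λ.ggjData_Φ'' g C hψ hR hD₁ hD₁c hu
  have hσ1 := Λ.ggjData_gσB2 g hψ hR hG hGS hu
  have hB := Λ.ggjData_gB2 g C hψ hR hG hu
  have hABpos := Λ.ggjData_gB2_pos g C hψ hR hG hGc hu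
  set Pd := (∫ θ in (0 : ℝ)..(2 * π), polarKernelDs Rc D D₁ θ (rayRadius ψ Rc Zc u θ) / D θ (rayRadius ψ Rc Zc u θ))
  set Aσ := (∫ θ in (0 : ℝ)..(2 * π), invGradKernel Rc D G θ (rayRadius ψ Rc Zc u θ))
  set AB := (∫ θ in (0 : ℝ)..(2 * π), bsqGradKernel g Rc D G θ (rayRadius ψ Rc Zc u θ))
  set W := (∫ θ in (0 : ℝ)..(2 * π), volKernel Rc D θ (rayRadius ψ Rc Zc u θ))
  set A2 := (∫ θ in (0 : ℝ)..(2 * π), bsqKernel g Rc D G θ (rayRadius ψ Rc Zc u θ))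
  set d := ggjData g C ψ Rc Zc u with hd
  have hV : d.V' ≠ 0 := (Λ.ggjData_V'_pos g C hψ hR hu).ne'
  have hshear : d.shear = -(2 * π) * d.Φ'' := by
    show d.Φ' * d.Ψ'' - d.Ψ' * d.Φ'' = _
    simp only [hd, ggjData]; ring
  have hΛ : d.shear ≠ 0 := by
    rw [hshear, hΦ2]; exact mul_ne_zero (neg_ne_zero.2 two_pi_pos.ne') (mul_ne_zero hg hPd)
  have hABne : d.gB2 ≠ 0 := hABpos.ne'
  have hAB' : AB ≠ 0 := by
    intro h0; apply hABne; rw [hB, h0, zero_div]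
  rw [d.ggjH_relabel_volume hV hΛ hABne, hshear, hV', hΦ2, hσ1, hB]
  have hπ : (π : ℝ) ≠ 0 := Real.pi_ne_zero
  field_simp

/-- **THE RESISTIVE-INTERCHANGE INDEX OF THE IMPLICIT SURFACE IN EIGHT REGISTERS**:
`D_R = −mercierRegisterForm g C Pd Wd Aσ As AB Ai/(4g²Pd²) + (−(C/Pd)·(Aσ − AB·W/A2) − 1/2)²` (`D_R = D_I + (H − 1/2)²`, Zheng (3.42);
force balance from `ggjData_isForceBalanced`; `g, Pd, A2 ≠ 0`). [cite: Zheng2015, §3.2 eq. (3.42)] -/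
theorem resistiveIndexE_eq_registerForm (Λ : LevelLoop ψ Rc Zc uin uout D N t σ₁ σ₂) (g : ℝ)
    (hψ : ∀ j < N, ∀ θ ∈ Icc (t j) (t (j + 1)), ∀ s ∈ Icc (σ₁ j) (σ₂ j),
      HasFDerivAt (fun p : ℝ × ℝ => ψ p.1 p.2) (L θ s) (rayPoint Rc Zc θ s))
    (hR : ∀ j < N, ∀ θ ∈ Icc (t j) (t (j + 1)), ∀ s ∈ Icc (σ₁ j) (σ₂ j), 0 < Rc + s * cos θ)
    (hD₁ : ∀ j < N, ∀ θ ∈ Icc (t j) (t (j + 1)), ∀ s ∈ Icc (σ₁ j) (σ₂ j), HasDerivAt (D θ) (D₁ θ s) s)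
    (hD₁c : ∀ j < N, ContinuousOn (fun p : ℝ × ℝ => D₁ p.1 p.2) (Icc (t j) (t (j + 1)) ×ˢ Icc (σ₁ j) (σ₂ j)))
    (hG : ∀ j < N, ∀ θ ∈ Icc (t j) (t (j + 1)), ∀ s ∈ Icc (σ₁ j) (σ₂ j), (L θ s (1, 0)) ^ 2 + (L θ s (0, 1)) ^ 2 = G θ s)
    (hGc : ∀ j < N, ContinuousOn (fun p : ℝ × ℝ => G p.1 p.2) (Icc (t j) (t (j + 1)) ×ˢ Icc (σ₁ j) (σ₂ j)))
    (hGS : ∀ j < N, ∀ θ ∈ Icc (t j) (t (j + 1)), ∀ s ∈ Icc (σ₁ j) (σ₂ j),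
      gsOperator ψ (Rc + s * cos θ) (Zc + s * sin θ) = C * (Rc + s * cos θ) ^ 2)
    (hσ : ∀ j < N, σ₂ j ≤ smax)
    (hk : ∀ j < N, ∀ θ ∈ Icc (t j) (t (j + 1)), ∀ s ∈ Icc (σ₁ j) (σ₂ j),
      k θ s * (Rc + s * cos θ) = tangentialDeriv (L θ s (1, 0)) (L θ s (0, 1)) θ)
    (hkc : ContinuousOn (fun p : ℝ × ℝ => k p.1 p.2) (univ ×ˢ Icc 0 smax))
    (hkθc : ContinuousOn (fun p : ℝ × ℝ => kθ p.1 p.2) (univ ×ˢ Icc 0 smax))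
    (hkθ : ∀ θ : ℝ, ∀ σ ∈ Icc 0 smax, HasDerivAt (fun θ' => k θ' σ) (kθ θ σ) θ)
    (hkper : ∀ σ : ℝ, k (2 * π) σ = k 0 σ)
    (hm : ∀ θ : ℝ, ∀ σ ∈ Icc 0 smax,
      HasDerivAt (fun s => s * D θ s / (Rc + s * cos θ)) (C * σ * (Rc + σ * cos θ) - kθ θ σ) σ)
    {u : ℝ} (hu : u ∈ Ioo uin uout) (hg : g ≠ 0)
    (hPd : (∫ θ in (0 : ℝ)..(2 * π), polarKernelDs Rc D D₁ θ (rayRadius ψ Rc Zc u θ) / D θ (rayRadius ψ Rc Zc u θ)) ≠ 0)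
    (hA2 : (∫ θ in (0 : ℝ)..(2 * π), bsqKernel g Rc D G θ (rayRadius ψ Rc Zc u θ)) ≠ 0) :
    resistiveIndexE g C ψ Rc Zc u
      = -(mercierRegisterForm g C
          (∫ θ in (0 : ℝ)..(2 * π), polarKernelDs Rc D D₁ θ (rayRadius ψ Rc Zc u θ) / D θ (rayRadius ψ Rc Zc u θ))
          (∫ θ in (0 : ℝ)..(2 * π), volKernelDs Rc D D₁ θ (rayRadius ψ Rc Zc u θ) / D θ (rayRadius ψ Rc Zc u θ))
          (∫ θ in (0 : ℝ)..(2 * π), invGradKernel Rc D G θ (rayRadius ψ Rc Zc u θ))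
          (∫ θ in (0 : ℝ)..(2 * π), sigmaSqKernel g Rc D G θ (rayRadius ψ Rc Zc u θ))
          (∫ θ in (0 : ℝ)..(2 * π), bsqGradKernel g Rc D G θ (rayRadius ψ Rc Zc u θ))
          (∫ θ in (0 : ℝ)..(2 * π), invBsqKernel g Rc D G θ (rayRadius ψ Rc Zc u θ)))
        / (4 * g ^ 2 * (∫ θ in (0 : ℝ)..(2 * π),
            polarKernelDs Rc D D₁ θ (rayRadius ψ Rc Zc u θ) / D θ (rayRadius ψ Rc Zc u θ)) ^ 2)
      + (-(C / (∫ θ in (0 : ℝ)..(2 * π), polarKernelDs Rc D D₁ θ (rayRadius ψ Rc Zc u θ) / D θ (rayRadius ψ Rc Zc u θ)))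
          * ((∫ θ in (0 : ℝ)..(2 * π), invGradKernel Rc D G θ (rayRadius ψ Rc Zc u θ))
            - (∫ θ in (0 : ℝ)..(2 * π), bsqGradKernel g Rc D G θ (rayRadius ψ Rc Zc u θ))
              * (∫ θ in (0 : ℝ)..(2 * π), volKernel Rc D θ (rayRadius ψ Rc Zc u θ))
              / ∫ θ in (0 : ℝ)..(2 * π), bsqKernel g Rc D G θ (rayRadius ψ Rc Zc u θ)) - 1 / 2) ^ 2 := by
  have hABpos := Λ.ggjData_gB2_pos g C hψ hR hG hGc hu
  unfold resistiveIndexE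
  rw [Λ.surfaceAverageE_sigmaBsq_eq g hψ hR hGS hu, Λ.surfaceAverageE_bsq_eq g hψ hR hG hu,
    SurfaceData.ggjDR_eq_ggjDI_add_sq,
    Λ.ggjDI_ggjData_eq_registerForm g hψ hR hD₁ hD₁c hG hGc hGS hσ hk hkc hkθc hkθ hkper hm hu hg hPd hABpos.ne' _ _,
    Λ.ggjH_ggjData_eq g hψ hR hD₁ hD₁c hG hGc hGS hu hg hPd hA2]

/-- **`D_R < 0` ON THE IMPLICIT SURFACE ⇒ JARDIN'S MERCIER CRITERION (8.134) THERE** (GGJ: the resistive-stable range implies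
`−D_I > 0`; label independence by the force balance; `g, Pd ≠ 0`). [cite: Zheng2015, §3.2 eq. (3.42)] -/
theorem mercierCriterion_of_resistiveIndexE_neg (Λ : LevelLoop ψ Rc Zc uin uout D N t σ₁ σ₂) (g : ℝ)
    (hψ : ∀ j < N, ∀ θ ∈ Icc (t j) (t (j + 1)), ∀ s ∈ Icc (σ₁ j) (σ₂ j),
      HasFDerivAt (fun p : ℝ × ℝ => ψ p.1 p.2) (L θ s) (rayPoint Rc Zc θ s))
    (hR : ∀ j < N, ∀ θ ∈ Icc (t j) (t (j + 1)), ∀ s ∈ Icc (σ₁ j) (σ₂ j), 0 < Rc + s * cos θ)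
    (hD₁ : ∀ j < N, ∀ θ ∈ Icc (t j) (t (j + 1)), ∀ s ∈ Icc (σ₁ j) (σ₂ j), HasDerivAt (D θ) (D₁ θ s) s)
    (hD₁c : ∀ j < N, ContinuousOn (fun p : ℝ × ℝ => D₁ p.1 p.2) (Icc (t j) (t (j + 1)) ×ˢ Icc (σ₁ j) (σ₂ j)))
    (hG : ∀ j < N, ∀ θ ∈ Icc (t j) (t (j + 1)), ∀ s ∈ Icc (σ₁ j) (σ₂ j), (L θ s (1, 0)) ^ 2 + (L θ s (0, 1)) ^ 2 = G θ s)
    (hGc : ∀ j < N, ContinuousOn (fun p : ℝ × ℝ => G p.1 p.2) (Icc (t j) (t (j + 1)) ×ˢ Icc (σ₁ j) (σ₂ j)))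
    (hσ : ∀ j < N, σ₂ j ≤ smax)
    (hk : ∀ j < N, ∀ θ ∈ Icc (t j) (t (j + 1)), ∀ s ∈ Icc (σ₁ j) (σ₂ j),
      k θ s * (Rc + s * cos θ) = tangentialDeriv (L θ s (1, 0)) (L θ s (0, 1)) θ)
    (hkc : ContinuousOn (fun p : ℝ × ℝ => k p.1 p.2) (univ ×ˢ Icc 0 smax))
    (hkθc : ContinuousOn (fun p : ℝ × ℝ => kθ p.1 p.2) (univ ×ˢ Icc 0 smax))
    (hkθ : ∀ θ : ℝ, ∀ σ ∈ Icc 0 smax, HasDerivAt (fun θ' => k θ' σ) (kθ θ σ) θ)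
    (hkper : ∀ σ : ℝ, k (2 * π) σ = k 0 σ)
    (hm : ∀ θ : ℝ, ∀ σ ∈ Icc 0 smax,
      HasDerivAt (fun s => s * D θ s / (Rc + s * cos θ)) (C * σ * (Rc + σ * cos θ) - kθ θ σ) σ)
    {u : ℝ} (hu : u ∈ Ioo uin uout) (hg : g ≠ 0)
    (hPd : (∫ θ in (0 : ℝ)..(2 * π), polarKernelDs Rc D D₁ θ (rayRadius ψ Rc Zc u θ) / D θ (rayRadius ψ Rc Zc u θ)) ≠ 0)
    (hneg : resistiveIndexE g C ψ Rc Zc u < 0) :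
    (ggjData g C ψ Rc Zc u).MercierCriterion := by
  set d := ggjData g C ψ Rc Zc u with hd
  have hV : d.V' ≠ 0 := (Λ.ggjData_V'_pos g C hψ hR hu).ne'
  have hΦ2 := Λ.ggjData_Φ'' g C hψ hR hD₁ hD₁c hu
  have hshear : d.shear = -(2 * π) * d.Φ'' := by
    show d.Φ' * d.Ψ'' - d.Ψ' * d.Φ'' = _
    simp only [hd, ggjData]; ring
  have hΛ : d.shear ≠ 0 := by
    rw [hshear]; exact mul_ne_zero (neg_ne_zero.2 two_pi_pos.ne') (by rw [show d.Φ'' = _ from hΦ2]; exact mul_ne_zero hg hPd)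
  have hABne : d.gB2 ≠ 0 := (Λ.ggjData_gB2_pos g C hψ hR hG hGc hu).ne'
  have hfb : d.IsForceBalanced := Λ.ggjData_isForceBalanced g hψ hR hG hGc hσ hk hkc hkθc hkθ hkper hm hu
  exact d.mercierCriterion_of_ggjDR_relabel_volume_neg hV hΛ hABne hfb hneg

end LevelLoop

end PolarRay

end Summit.Ventures.FusionMHD.Models

end
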